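import Literature.Probability.LatticeModels.GlauberCovarianceDecay
import Literature.Probability.LatticeModels.StrongMixingRelativeDensities
import HarnessLib

/-!
# `SMT` on all multiples of `Q_{L₀}` ⇒ strong mixing on all multiples of `Q_{L₀}`
# ([Mar99] Theorem 2.7, (ii) ⇒ (i)), PROVED

Topic `Literature/Probability/LatticeModels`; cell `ym-ir`, seat lit-3 (census rows B2/B4).  This file proves, as
a `theorem` and with no new named fact (D-0026), the direction (ii) ⇒ (i) of [Mar99] Theorem 2.7 — the `←`
direction of the typed fact `Martinelli1999_strongMixing_iff_SMT` (`StrongMixingFiniteSize.lean`), in exactly its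
quantifier shape (`Glauber.strongMixing_of_SMT'`).  The direction (i) ⇒ (ii) (strong mixing ⇒ `SMT`, [Mar99]
p0158 L27 – p0159, via the coupling/partition argument) is NOT proved here, so the `iff` fact itself stays a named
fact.  SIBLING-SETTING result (finite-range interactions, `±1` spins on `ℤ^d`); nothing here is a statement about
gauge theories, and the Yang–Mills mass gap is not touched by it.

Source (held; `book:bertoin1999-lectures-probability-theory-statistics`): [Mar99] F. Martinelli, *Lectures on
Glauber dynamics for discrete spin models*, LNM 1717 (1999), Theorem 2.7 p0158 L19–26, proof of (ii) ⇒ (i)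
p0160 L1–16 with Lemma 2.8 p0160 and (2.14)–(2.15). [cite: Martinelli1999, Theorem 2.7]

Contents:
* `sum_exp_neg_mul_natAbs_le_two_mul`, `sum_exp_neg_mul_supDist_le_pow` — the lattice sums `Σ_{k∈T} e^{−c|a−k|} ≤ 2/(1−e^{−c})`
  (`T ⊆ ℤ` finite) and `Σ_{z∈F} e^{−c d(y,z)} ≤ (2/(1−e^{−c/d}))^d` (`F ⊆ ℤ^d` finite).
* `mem_cubeQ`, `eq_ediv_of_mem_cubeQ`, `disjoint_cubeQ`, `supDist_lt_of_mem_cubeQ` — the cubes `Q_L(Lx + o)`,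
  `x ∈ ℤ^d`, are pairwise disjoint and have diameter `< L`.
* `Glauber.strongMixing_of_SMT` — **Theorem 2.7 (ii) ⇒ (i)** with explicit rate `m/2`: `SMT(Λ, l, m)` for all
  `Λ ∈ 𝓕_{L₀}` gives `C ≥ 0` with `SM(Λ, C, m/2)` for all `Λ ∈ 𝓕_{L₀}`.  Proof as printed: `Δ` is replaced by the
  union `Δ̂` of the cubes of `Λ` meeting it, `Λ ∖ Δ̂ ∈ 𝓕_{L₀}` (disjointness of the cubes), the third line of
  (2.15) is `Glauber.abs_spec_real_spinFlip_sub_le_sum_exp` (`StrongMixingRelativeDensities.lean`, Lemma 2.8 with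
  `U = Λ ∖ Δ̂`), every `z ∈ Δ̂` has `d(z,y) ≥ d(Δ,y) − (L₀ − 1)`, and the remaining sum `Σ_{z∈Δ̂} e^{−(m/2)d(y,z)}`
  is bounded by the lattice-sum lemma; boundary sites `y` with `d(Δ,y) ≤ r + L₀ − 1` (for which some cube of `Δ̂`
  is within the range `r` of `y` and Lemma 2.8 does not apply) are absorbed in the constant, the two probabilities
  differing by at most `1`.  [Mar99] keeps the rate `m` up to the constant `A = A(L₀, m)` of p0160 L16–17; we give away
  `m/2` to absorb the polynomial shell factor, which the fact's existential `m` permits.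
* `Glauber.strongMixing_of_SMT'` — the same in the quantifier shape of `Martinelli1999_strongMixing_iff_SMT` (`.2`
  direction).
-/

open MeasureTheory ProbabilityTheory Finset

noncomputable section

namespace Literature.Probability.LatticeModels

variable {d : ℕ}

/-! ### Exponential lattice sums -/

section LatticeSums

/-- A geometric tail: for a finite set of natural numbers, `Σ_{n∈N} q^n ≤ (1−q)⁻¹` (`0 ≤ q < 1`). [folklore] -/
private theorem sum_pow_le_inv_one_sub {q : ℝ} (hq0 : 0 ≤ q) (hq1 : q < 1) (N : Finset ℕ) :
    ∑ n ∈ N, q ^ n ≤ (1 - q)⁻¹ :=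
  sum_le_hasSum N (fun n _ => pow_nonneg hq0 n) (hasSum_geometric_of_lt_one hq0 hq1)

/-- **One-dimensional exponential sum**: `Σ_{k∈T} e^{−c|a−k|} ≤ 2(1 − e^{−c})⁻¹` for every finite `T ⊆ ℤ`.
[cite: Martinelli1999, Theorem 2.7, proof, (2.15)] -/
theorem sum_exp_neg_mul_natAbs_le_two_mul {c : ℝ} (hc : 0 < c) (a : ℤ) (T : Finset ℤ) :
    ∑ k ∈ T, Real.exp (-(c * ((a - k).natAbs : ℝ))) ≤ 2 * (1 - Real.exp (-c))⁻¹ := by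
  set q := Real.exp (-c) with hq
  have hq0 : 0 ≤ q := (Real.exp_pos _).le
  have hq1 : q < 1 := Real.exp_lt_one_iff.2 (by linarith)
  have hterm : ∀ k : ℤ, Real.exp (-(c * ((a - k).natAbs : ℝ))) = q ^ (a - k).natAbs := fun k => by
    rw [hq, ← Real.exp_nat_mul]
    congr 1
    ring
  simp_rw [hterm]
  -- split at `a`
  rw [← Finset.sum_filter_add_sum_filter_not T (fun k => a ≤ k)]
  have h1 : ∑ k ∈ T.filter (fun k => a ≤ k), q ^ (a - k).natAbs ≤ (1 - q)⁻¹ := by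
    rw [← Finset.sum_image (f := fun n : ℕ => q ^ n) (g := fun k : ℤ => (a - k).natAbs) ?_]
    · exact sum_pow_le_inv_one_sub hq0 hq1 _
    · intro k hk k' hk' hkk'
      have ha := (Finset.mem_filter.1 (Finset.mem_coe.1 hk)).2
      have ha' := (Finset.mem_filter.1 (Finset.mem_coe.1 hk')).2
      simp only at hkk'
      omega
  have h2 : ∑ k ∈ T.filter (fun k => ¬ a ≤ k), q ^ (a - k).natAbs ≤ (1 - q)⁻¹ := by
    rw [← Finset.sum_image (f := fun n : ℕ => q ^ n) (g := fun k : ℤ => (a - k).natAbs) ?_]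
    · exact sum_pow_le_inv_one_sub hq0 hq1 _
    · intro k hk k' hk' hkk'
      have ha := (Finset.mem_filter.1 (Finset.mem_coe.1 hk)).2
      have ha' := (Finset.mem_filter.1 (Finset.mem_coe.1 hk')).2
      simp only at hkk'
      omega
  linarith

/-- A positive ℓ^∞ distance forces `d > 0`. [folklore] -/
private theorem pos_of_supDist_pos {x y : Site d} (h : 0 < supDist x y) : 0 < d := by
  by_contra hd
  have hd0 : d = 0 := by omega
  subst hd0
  have : supDist x y = 0 := by
    unfold supDist
    simp
  omega

/-- **Exponential lattice sum in `ℤ^d`**: `Σ_{z∈F} e^{−c d(y,z)} ≤ (2(1 − e^{−c/d})⁻¹)^d` for every finite `F`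
(`e^{−c d(y,z)} ≤ Π_i e^{−(c/d)|y_i − z_i|}`, then the box containing `F` factorises the sum).
[cite: Martinelli1999, Theorem 2.7, proof, (2.15)] -/
theorem sum_exp_neg_mul_supDist_le_pow {c : ℝ} (hc : 0 < c) (hd : 0 < d) (y : Site d) (F : Finset (Site d)) :
    ∑ z ∈ F, Real.exp (-(c * (supDist y z : ℝ))) ≤ (2 * (1 - Real.exp (-(c / d)))⁻¹) ^ d := by
  classical
  have hcd : 0 < c / d := div_pos hc (by exact_mod_cast hd)
  -- pointwise factorisation bound
  have hpt : ∀ z : Site d, Real.exp (-(c * (supDist y z : ℝ))) ≤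
      ∏ i, Real.exp (-(c / d * ((y i - z i).natAbs : ℝ))) := by
    intro z
    rw [← Real.exp_sum, Real.exp_le_exp, Finset.sum_neg_distrib, ← Finset.mul_sum, neg_le_neg_iff]
    have hsum : ∑ i : Fin d, ((y i - z i).natAbs : ℝ) ≤ d * supDist y z := by
      calc ∑ i : Fin d, ((y i - z i).natAbs : ℝ) ≤ ∑ _i : Fin d, (supDist y z : ℝ) :=
            Finset.sum_le_sum fun i _ => by exact_mod_cast natAbs_sub_le_supDist y z i
        _ = d * supDist y z := by rw [Finset.sum_const, Finset.card_univ, Fintype.card_fin, nsmul_eq_mul]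
    have hd' : (d : ℝ) ≠ 0 := by exact_mod_cast hd.ne'
    calc c / d * ∑ i : Fin d, ((y i - z i).natAbs : ℝ) ≤ c / d * (d * supDist y z) :=
          mul_le_mul_of_nonneg_left hsum hcd.le
      _ = c * supDist y z := by rw [← mul_assoc, div_mul_cancel₀ c hd']
  -- the box
  set t : Fin d → Finset ℤ := fun i => F.image fun z => z i with ht
  have hF : F ⊆ Fintype.piFinset t := fun z hz => Fintype.mem_piFinset.2 fun i => Finset.mem_image.2 ⟨z, hz, rfl⟩
  calc ∑ z ∈ F, Real.exp (-(c * (supDist y z : ℝ)))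
      ≤ ∑ z ∈ F, ∏ i, Real.exp (-(c / d * ((y i - z i).natAbs : ℝ))) := Finset.sum_le_sum fun z _ => hpt z
    _ ≤ ∑ z ∈ Fintype.piFinset t, ∏ i, Real.exp (-(c / d * ((y i - z i).natAbs : ℝ))) :=
        Finset.sum_le_sum_of_subset_of_nonneg hF fun z _ _ => Finset.prod_nonneg fun i _ => (Real.exp_pos _).le
    _ = ∏ i, ∑ k ∈ t i, Real.exp (-(c / d * ((y i - k).natAbs : ℝ))) :=
        (Finset.prod_univ_sum t (fun i k => Real.exp (-(c / d * ((y i - k).natAbs : ℝ))))).symm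
    _ ≤ ∏ _i : Fin d, (2 * (1 - Real.exp (-(c / d)))⁻¹) := by
        refine Finset.prod_le_prod (fun i _ => Finset.sum_nonneg fun k _ => (Real.exp_pos _).le) fun i _ => ?_
        exact sum_exp_neg_mul_natAbs_le_two_mul hcd (y i) (t i)
    _ = (2 * (1 - Real.exp (-(c / d)))⁻¹) ^ d := by
        rw [Finset.prod_const, Finset.card_univ, Fintype.card_fin]

end LatticeSums

/-! ### Cubes `Q_L(Lx + o)` tile `ℤ^d` -/

section Cubes

/-- Membership in `Q_L(c)`. [cite: Martinelli1999, §2.1] -/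
theorem mem_cubeQ {L : ℕ} {c z : Site d} : z ∈ cubeQ L c ↔ ∀ i, c i ≤ z i ∧ z i < c i + L := by
  simp [cubeQ, Fintype.mem_piFinset]

/-- The lattice label of the cube `Q_L(Lx + o)` containing `z` is determined by `z`: `x_i = ⌊(z_i − o_i)/L⌋`.
[cite: Martinelli1999, §2.1] -/
theorem eq_ediv_of_mem_cubeQ {L : ℕ} (hL : 0 < L) {o x z : Site d} (hz : z ∈ cubeQ L (L • x + o)) (i : Fin d) :
    x i = (z i - o i) / (L : ℤ) := by
  have h := (mem_cubeQ.1 hz) i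
  simp only [Pi.add_apply, nsmul_eq_mul, Pi.mul_apply, Pi.natCast_apply] at h
  have hL' : (0 : ℤ) < L := by exact_mod_cast hL
  obtain ⟨h1, h2⟩ := h
  have e1 : x i ≤ (z i - o i) / (L : ℤ) := by
    rw [Int.le_ediv_iff_mul_le hL']
    linarith
  have e2 : (z i - o i) / (L : ℤ) < x i + 1 := by
    rw [Int.ediv_lt_iff_lt_mul hL']
    linarith
  exact le_antisymm e1 (Int.lt_add_one_iff.1 e2)

/-- Distinct lattice cubes are disjoint. [cite: Martinelli1999, §2.1] -/
theorem disjoint_cubeQ {L : ℕ} (hL : 0 < L) (o : Site d) {x x' : Site d} (h : x ≠ x') :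
    Disjoint (cubeQ L (L • x + o)) (cubeQ L (L • x' + o)) := by
  rw [Finset.disjoint_left]
  intro z hz hz'
  exact h (funext fun i => by rw [eq_ediv_of_mem_cubeQ hL hz i, eq_ediv_of_mem_cubeQ hL hz' i])

/-- Two points of one cube `Q_L` (`L ≥ 1`) are at ℓ^∞ distance `< L`. [cite: Martinelli1999, §2.1] -/
theorem supDist_lt_of_mem_cubeQ {L : ℕ} (hL : 0 < L) {c z w : Site d} (hz : z ∈ cubeQ L c)
    (hw : w ∈ cubeQ L c) : supDist z w < L := by
  have h : supDist z w ≤ L - 1 := supDist_le_iff.2 fun i => by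
    have h1 := (mem_cubeQ.1 hz) i
    have h2 := (mem_cubeQ.1 hw) i
    omega
  omega

end Cubes

namespace Glauber

variable {r : ℕ}

/-! ### Theorem 2.7, (ii) ⇒ (i) -/

/-- The difference of two probabilities is at most one in absolute value. [folklore] -/
private theorem abs_real_sub_real_le_one {μ ν : Measure (Site d → ℤˣ)} [IsProbabilityMeasure μ]
    [IsProbabilityMeasure ν] (A : Set (Site d → ℤˣ)) : |μ.real A - ν.real A| ≤ 1 := by
  rw [abs_sub_le_iff]
  constructor <;> linarith [measureReal_nonneg (μ := μ) (s := A), measureReal_nonneg (μ := ν) (s := A),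
    measureReal_le_one (μ := μ) (s := A), measureReal_le_one (μ := ν) (s := A)]

/-- **[Mar99] Theorem 2.7, (ii) ⇒ (i)**: if `SMT(Λ, l, m)` holds (uniformly in the boundary condition) for all
multiples `Λ` of `Q_{L₀}` (`m > 0`, `L₀ > 0`), then there is `C` with `SM(Λ, C, m/2)` for all multiples `Λ` of
`Q_{L₀}`.  Printed proof (p0160 L5–16): replace `Δ` by the union `Δ̂` of the cubes of `Λ` meeting it, so that
`Λ ∖ Δ̂` is again a multiple of `Q_{L₀}`; apply Lemma 2.8 with `U = Λ ∖ Δ̂` and `SMT(U, l, m)` ((2.14)–(2.15));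
sum `Σ_{x∈Δ̂} e^{−m d(x,y)} ≤ A Σ_{x∈Δ} e^{−m d(x,y)}` and over shells.  Here: the third line of (2.15) is
`abs_spec_real_spinFlip_sub_le_sum_exp`; every `z ∈ Δ̂` has `d(z,y) ≥ d(Δ,y) − (L₀ − 1)`, and the lattice sum
`Σ_z e^{−(m/2) d(y,z)}` is bounded by `sum_exp_neg_mul_supDist_le_pow`; boundary sites within distance `r` of `Δ̂`
(where Lemma 2.8 does not apply) have `d(Δ,y) ≤ r + L₀ − 1` and are absorbed in the constant.
[cite: Martinelli1999, Theorem 2.7] -/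
theorem strongMixing_of_SMT (U : FRPotential d ℤˣ r) (β : ℝ) {l m : ℝ} {L₀ : ℕ} (hm : 0 < m) (hL₀ : 0 < L₀)
    (hSMT : ∀ Λ ∈ classF d L₀, SMT (U.spec β) Λ l m) :
    ∃ C : ℝ, 0 ≤ C ∧ ∀ Λ ∈ classF d L₀, StrongMixing (U.spec β) Λ C (m / 2) := by
  classical
  have hγ := U.isSpecification_spec β
  obtain ⟨R, hR1, hR⟩ := exists_flipWeight_bounds U β
  set l' : ℝ := max l 0 with hl'
  set K : ℝ := 4 * R ^ 4 * (2 * r + 1 : ℝ) ^ (2 * d) * Real.exp (m * (l' + 2 * r)) with hK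
  set S : ℝ := (2 * (1 - Real.exp (-(m / 2 / d)))⁻¹) ^ d with hS
  set C : ℝ := max (Real.exp (m / 2 * (r + L₀))) (K * Real.exp (m / 2 * (L₀ - 1)) * S) with hC
  have hC0 : 0 ≤ C := le_max_of_le_left (Real.exp_pos _).le
  refine ⟨C, hC0, ?_⟩
  rintro Λ ⟨o, ho, I, rfl⟩ Δ hΔ yb hyb τ τ' hττ' A hA hdA
  haveI := hγ.isProbability (I.biUnion fun x => cubeQ L₀ (L₀ • x + o)) τ
  haveI := hγ.isProbability (I.biUnion fun x => cubeQ L₀ (L₀ • x + o)) τ'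
  set Λ := I.biUnion fun x => cubeQ L₀ (L₀ • x + o) with hΛ
  set D : ℕ := finsetSupDist Δ {yb} with hD
  -- `τ' = τ` or `τ' = τ^{yb}`
  by_cases heq : τ' yb = τ yb
  · have : τ' = τ := funext fun z => by
      by_cases hz : z = yb
      · rw [hz, heq]
      · exact (hττ' z hz).symm
    rw [this, sub_self, abs_zero]
    positivity
  have hflip : τ' = spinFlip yb τ := by
    funext z
    rw [spinFlip_apply]
    by_cases hz : z = yb
    · rw [if_pos hz, hz]
      exact Int.units_ne_iff_eq_neg.1 heq
    · rw [if_neg hz]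
      exact (hττ' z hz).symm
  subst hflip
  rw [abs_sub_comm]
  -- trivial case: `d(Δ, yb) ≤ r + L₀ − 1`
  by_cases htriv : D + 1 ≤ r + L₀
  · calc |(U.spec β Λ (spinFlip yb τ)).real A - (U.spec β Λ τ).real A| ≤ 1 := abs_real_sub_real_le_one A
      _ ≤ Real.exp (m / 2 * (r + L₀)) * Real.exp (-(m / 2 * (D : ℝ))) := by
          rw [← Real.exp_add]
          refine Real.one_le_exp ?_
          have : (D : ℝ) + 1 ≤ r + L₀ := by exact_mod_cast htriv
          nlinarith
      _ ≤ C * Real.exp (-(m / 2 * (finsetSupDist Δ {yb} : ℝ))) := by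
          rw [← hD]
          exact mul_le_mul_of_nonneg_right (le_max_left _ _) (Real.exp_pos _).le
  -- main case
  have hDge : r + L₀ ≤ D := by omega
  have hΔne : Δ.Nonempty := by
    by_contra hΔe
    rw [Finset.not_nonempty_iff_eq_empty] at hΔe
    have : D = 0 := by rw [hD, hΔe]; simp [finsetSupDist]
    omega
  -- the enlarged set `Δ̂` and its complement in `Λ`
  set I' := I.filter fun x => (cubeQ L₀ (L₀ • x + o) ∩ Δ).Nonempty with hI'
  set I'' := I.filter fun x => ¬ (cubeQ L₀ (L₀ • x + o) ∩ Δ).Nonempty with hI''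
  set Δh := I'.biUnion fun x => cubeQ L₀ (L₀ • x + o) with hΔh
  set U' := I''.biUnion fun x => cubeQ L₀ (L₀ • x + o) with hU'
  have hΔΔh : Δ ⊆ Δh := by
    intro z hz
    obtain ⟨x, hx, hzx⟩ := Finset.mem_biUnion.1 (hΔ hz)
    exact Finset.mem_biUnion.2 ⟨x, Finset.mem_filter.2 ⟨hx, ⟨z, Finset.mem_inter.2 ⟨hzx, hz⟩⟩⟩, hzx⟩
  have hΔhΛ : Δh ⊆ Λ := Finset.biUnion_subset_biUnion_of_subset_left _ (Finset.filter_subset _ _)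
  have hdiff : Λ \ Δh = U' := by
    ext z
    simp only [Finset.mem_sdiff, hΛ, hΔh, hU', Finset.mem_biUnion, hI', hI'', Finset.mem_filter]
    constructor
    · rintro ⟨⟨x, hx, hzx⟩, hnot⟩
      refine ⟨x, ⟨hx, fun hne => hnot ⟨x, ⟨hx, hne⟩, hzx⟩⟩, hzx⟩
    · rintro ⟨x, ⟨hx, hne⟩, hzx⟩
      refine ⟨⟨x, hx, hzx⟩, ?_⟩
      rintro ⟨x', ⟨hx', hne'⟩, hzx'⟩
      have hxx' : x = x' := by
        by_contra hxx'
        exact Finset.disjoint_left.1 (disjoint_cubeQ hL₀ o hxx') hzx hzx'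
      exact hne (hxx' ▸ hne')
  have hU'F : U' ∈ classF d L₀ := ⟨o, ho, I'', rfl⟩
  have hnear : ∀ z ∈ Δh, ∃ w ∈ Δ, supDist z w < L₀ := by
    intro z hz
    obtain ⟨x, hx, hzx⟩ := Finset.mem_biUnion.1 hz
    obtain ⟨w, hw⟩ := (Finset.mem_filter.1 hx).2
    obtain ⟨hwx, hwΔ⟩ := Finset.mem_inter.1 hw
    exact ⟨w, hwΔ, supDist_lt_of_mem_cubeQ hL₀ hzx hwx⟩
  have tri : ∀ p q s : Site d, supDist p s ≤ supDist p q + supDist q s := fun p q s => by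
    rw [supDist_le_iff]
    intro i
    have e1 := natAbs_sub_le_supDist p q i
    have e2 := natAbs_sub_le_supDist q s i
    have : p i - s i = (p i - q i) + (q i - s i) := by ring
    rw [this]
    exact (Int.natAbs_add_le _ _).trans (add_le_add e1 e2)
  have hzfar : ∀ z ∈ Δh, D ≤ supDist yb z + (L₀ - 1) := by
    intro z hz
    obtain ⟨w, hw, hzw⟩ := hnear z hz
    have h1 : D ≤ supDist w yb := by
      rw [hD]
      exact finsetSupDist_le hw (Finset.mem_singleton_self yb)
    have h2 := tri w z yb
    rw [supDist_comm w z] at h2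
    rw [supDist_comm yb z]
    omega
  have hfar : ∀ z ∈ Δh, r < supDist z yb := by
    intro z hz
    have := hzfar z hz
    rw [supDist_comm] at this
    omega
  have hdA' : DependsOn (· ∈ A) (↑Δh : Set (Site d)) := fun σ σ' h =>
    hdA fun i hi => h i (Finset.mem_coe.2 (hΔΔh (Finset.mem_coe.1 hi)))
  have hSMT' : ∀ ζ : Site d → ℤˣ, SMT (U.spec β) (Λ \ Δh) l' m := fun _ => by
    rw [hdiff]
    exact (hSMT U' hU'F).mono (le_max_left _ _) le_rfl
  have hbound := abs_spec_real_spinFlip_sub_le_sum_exp U β hR1 hR hΔhΛ hyb hfar hA hdA' (le_max_right _ _)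
    hm.le hSMT' τ
  -- the lattice sum
  have hd : 0 < d := by
    obtain ⟨w, hw⟩ := hΔne
    have h1 : D ≤ supDist w yb := by
      rw [hD]
      exact finsetSupDist_le hw (Finset.mem_singleton_self yb)
    exact pos_of_supDist_pos (lt_of_lt_of_le (by omega) h1)
  have hlat : ∑ z ∈ Δh, Real.exp (-(m * (supDist yb z : ℝ))) ≤
      Real.exp (m / 2 * (L₀ - 1)) * S * Real.exp (-(m / 2 * (D : ℝ))) := by
    have hpt : ∀ z ∈ Δh, Real.exp (-(m * (supDist yb z : ℝ))) ≤
        Real.exp (m / 2 * (L₀ - 1)) * Real.exp (-(m / 2 * (D : ℝ))) * Real.exp (-(m / 2 * (supDist yb z : ℝ))) := by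
      intro z hz
      rw [← Real.exp_add, ← Real.exp_add, Real.exp_le_exp]
      have h1 : (D : ℝ) ≤ supDist yb z + ((L₀ - 1 : ℕ) : ℝ) := by exact_mod_cast hzfar z hz
      have h2 : ((L₀ - 1 : ℕ) : ℝ) = (L₀ : ℝ) - 1 := by
        rw [Nat.cast_sub (by omega)]
        simp
      rw [h2] at h1
      nlinarith
    calc ∑ z ∈ Δh, Real.exp (-(m * (supDist yb z : ℝ)))
        ≤ ∑ z ∈ Δh, Real.exp (m / 2 * (L₀ - 1)) * Real.exp (-(m / 2 * (D : ℝ))) *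
            Real.exp (-(m / 2 * (supDist yb z : ℝ))) := Finset.sum_le_sum hpt
      _ = Real.exp (m / 2 * (L₀ - 1)) * Real.exp (-(m / 2 * (D : ℝ))) *
            ∑ z ∈ Δh, Real.exp (-(m / 2 * (supDist yb z : ℝ))) := by rw [Finset.mul_sum]
      _ ≤ Real.exp (m / 2 * (L₀ - 1)) * Real.exp (-(m / 2 * (D : ℝ))) * S := by
          refine mul_le_mul_of_nonneg_left ?_ (by positivity)
          rw [hS]
          exact sum_exp_neg_mul_supDist_le_pow (half_pos hm) hd yb Δh
      _ = Real.exp (m / 2 * (L₀ - 1)) * S * Real.exp (-(m / 2 * (D : ℝ))) := by ring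
  have hS0 : 0 ≤ S := by
    rw [hS]
    refine pow_nonneg (mul_nonneg zero_le_two (inv_nonneg.2 ?_)) d
    have : Real.exp (-(m / 2 / d)) ≤ 1 := Real.exp_le_one_iff.2 (by
      have : (0 : ℝ) ≤ m / 2 / d := by positivity
      linarith)
    linarith
  calc |(U.spec β Λ (spinFlip yb τ)).real A - (U.spec β Λ τ).real A|
      ≤ 4 * R ^ 4 * (2 * r + 1 : ℝ) ^ (2 * d) * Real.exp (m * (l' + 2 * r)) *
          ∑ z ∈ Δh, Real.exp (-(m * (supDist yb z : ℝ))) := hbound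
    _ = K * ∑ z ∈ Δh, Real.exp (-(m * (supDist yb z : ℝ))) := by rw [hK]
    _ ≤ K * (Real.exp (m / 2 * (L₀ - 1)) * S * Real.exp (-(m / 2 * (D : ℝ)))) :=
        mul_le_mul_of_nonneg_left hlat (by positivity)
    _ = (K * Real.exp (m / 2 * (L₀ - 1)) * S) * Real.exp (-(m / 2 * (D : ℝ))) := by ring
    _ ≤ C * Real.exp (-(m / 2 * (finsetSupDist Δ {yb} : ℝ))) := by
        rw [← hD]
        exact mul_le_mul_of_nonneg_right (le_max_right _ _) (Real.exp_pos _).le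

/-- **[Mar99] Theorem 2.7, (ii) ⇒ (i), in the quantifier shape of the typed fact**
`Martinelli1999_strongMixing_iff_SMT` (its `←` direction): exponential decay of finite-volume covariances on
all multiples of `Q_{L₀}` implies strong mixing on all multiples of `Q_{L₀}`. [cite: Martinelli1999, Theorem 2.7] -/
theorem strongMixing_of_SMT' (U : FRPotential d ℤˣ r) (β : ℝ)
    (h : ∃ (l m : ℝ) (L₀ : ℕ), 0 < m ∧ 0 < L₀ ∧ ∀ Λ ∈ classF d L₀, SMT (U.spec β) Λ l m) :
    ∃ (C m : ℝ) (L₀ : ℕ), 0 < m ∧ 0 < L₀ ∧ ∀ Λ ∈ classF d L₀, StrongMixing (U.spec β) Λ C m := by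
  obtain ⟨l, m, L₀, hm, hL₀, hSMT⟩ := h
  obtain ⟨C, -, hC⟩ := strongMixing_of_SMT U β hm hL₀ hSMT
  exact ⟨C, m / 2, L₀, half_pos hm, hL₀, hC⟩

end Glauber

end Literature.Probability.LatticeModels

end
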